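import Summits.AtomisticToContinuum.HydrodynamicLimit.Theorems.JParityClosureCollisionTightnessGibbsWindow
import HarnessLib

/-!
# `UGibbsSRBRigidity.TemperedCollisions` (stmt-AtomisticToContinuum-9391), step 5:
# pair functionals under the homogeneous Gibbs law

Helper file (`--supports stmt-AtomisticToContinuum-9391`).  Under the homogeneous Gibbs law
`G_N = localGibbsMeasure σ a ū θ N` (`a, θ > 0`, `0 < σ ≤ 1/4`) and for a jointly measurable weight `g(y, u) ≥ 0`
of a relative position and a relative velocity whose Haar integral in `y` is at most `B` whatever `u` and the
centre, `E_{G_N} Σ_{p ≠ q} g(x_p − x_q, v_p − v_q) ≤ 2 (N+1)² B` (`lintegral_pairSum_le`): disintegration into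
positions and independent Gaussian velocities (`lintegral_localGibbsMeasure`), dropping the hard-core constraints of
one sphere and integrating its centre first (`lintegral_pos_pairWeight_le`, the functional form of
`lintegral_pos_window_le`), and the partition-function ratio `vol(posDomain N) ≤ 2 vol(posDomain (N+1))` at small
reduced density (`volume_posDomain_le_two_mul`).  NO velocity moment enters: the bound `B` is uniform in `u`.
This is the rung-0 (equilibrium) instance of the pair-correlation hypothesis of the reduction, with constant `2`.

References: D. Ruelle, *Statistical Mechanics: Rigorous Results* (1969), §4.2; H. Spohn (1991), Part I §2.3.
-/

noncomputable section

open MeasureTheory Set Filter Topology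
open scoped ENNReal InnerProductSpace

namespace Summit.AtomisticToContinuum.HydrodynamicLimit.Theorems

open Literature.Analysis.FluidPDE Literature.MathematicalPhysics.KineticTheory
open Literature.Analysis.FunctionSpaces

/-! ### The pair-sum bound under a homogeneous Gibbs law -/

/-- **The position integral, functional form.** For a jointly measurable weight `g(y, u)` whose Haar integral in
`y` is at most `B` whatever the centre, a label `i` and another label `j = i.succAbove j'`, the Haar integral
over the `N + 1` centres of `𝟙{the centres other than i do not overlap} · g(xᵢ − xⱼ, u)` is at most
`B · vol (posDomain ε N)` (Fubini over `xᵢ` first, `measurePreserving_piFinSuccAbove`). [folklore] -/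
theorem lintegral_pos_pairWeight_le {ε : ℝ} {N : ℕ} (i : Fin (N + 1)) (j' : Fin N)
    {g : T3 → V3 → ℝ≥0∞} (hg : Measurable (Function.uncurry g)) {B : ℝ≥0∞}
    (hB : ∀ (c : T3) (u : V3), ∫⁻ y, g (y - c) u ≤ B) (u : V3) :
    ∫⁻ x : Fin (N + 1) → T3, (posDomain ε N).indicator 1 (Fin.removeNth i x) *
        g (x i - x (i.succAbove j')) u ≤
      B * volume (posDomain ε N) := by
  have hmp : MeasurePreserving (MeasurableEquiv.piFinSuccAbove (fun _ : Fin (N + 1) => T3) i)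
      volume volume :=
    volume_preserving_piFinSuccAbove (fun _ : Fin (N + 1) => T3) i
  have hvol : (volume : Measure (T3 × (Fin N → T3))) = (volume : Measure T3).prod volume := rfl
  have hgu : Measurable fun y : T3 => g y u := hg.comp (measurable_id.prodMk measurable_const)
  -- product-side integrand
  set Fp : T3 × (Fin N → T3) → ℝ≥0∞ := fun p =>
    (posDomain ε N).indicator 1 p.2 * g (p.1 - p.2 j') u with hFp
  have hFpm : Measurable Fp :=
    ((measurable_one.indicator (measurableSet_posDomain ε N)).comp measurable_snd).mul
      (hgu.comp (measurable_fst.sub ((measurable_pi_apply j').comp measurable_snd)))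
  have hcomp : (fun x : Fin (N + 1) → T3 => (posDomain ε N).indicator 1 (Fin.removeNth i x) *
      g (x i - x (i.succAbove j')) u) =
      fun x => Fp (MeasurableEquiv.piFinSuccAbove (fun _ : Fin (N + 1) => T3) i x) := by
    funext x
    rfl
  rw [hcomp, hmp.lintegral_comp hFpm, hvol, lintegral_prod_symm _ hFpm.aemeasurable]
  have hinner : ∀ x' : Fin N → T3, ∫⁻ y, Fp (y, x') ≤ (posDomain ε N).indicator 1 x' * B := by
    intro x'
    have hsec : (fun y : T3 => Fp (y, x')) = fun y => (posDomain ε N).indicator 1 x' * g (y - x' j') u := by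
      funext y
      rfl
    have hm : Measurable fun y : T3 => g (y - x' j') u := hgu.comp (measurable_sub_const _)
    rw [hsec, lintegral_const_mul _ hm]
    gcongr
    exact hB (x' j') u
  calc ∫⁻ x', ∫⁻ y, Fp (y, x') ≤ ∫⁻ x', (posDomain ε N).indicator 1 x' * B := lintegral_mono hinner
    _ = B * volume (posDomain ε N) := by
        rw [lintegral_mul_const _ (measurable_one.indicator (measurableSet_posDomain ε N)),
          lintegral_indicator_one (measurableSet_posDomain ε N), mul_comm]

/-- **Relaxing the hard core of one sphere (disintegration step).** Under `G_N = localGibbsMeasure σ a ū θ N`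
(`a, θ > 0`, `σ ≤ 1/2`), for `i` and `j = i.succAbove j'` and a jointly measurable weight `g`,
`E_{G_N} g(xᵢ − xⱼ, vᵢ − vⱼ) ≤ ∫ dγ^{⊗(N+1)}(v) ∫ dx V_{N+1}⁻¹ 𝟙{centres other than i do not overlap} g(xᵢ − xⱼ, vᵢ − vⱼ)`
(`lintegral_localGibbsMeasure`, `Z = a^{N+1} V_{N+1}`, dropping the constraints of sphere `i`, Tonelli). [folklore] -/
theorem lintegral_pairWeight_le_relaxed {a θ : ℝ} (ha : 0 < a) (hθ : 0 < θ) (ubar : V3) {σ : ℝ} (hσ2 : σ ≤ 1 / 2)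
    (N : ℕ) (i : Fin (N + 1)) (j' : Fin N) {g : T3 → V3 → ℝ≥0∞} (hg : Measurable (Function.uncurry g)) :
    ∫⁻ z, g ((z i).1 - (z (i.succAbove j')).1) ((z i).2 - (z (i.succAbove j')).2)
        ∂localGibbsMeasure σ (fun _ => a) (fun _ => ubar) (fun _ => θ) N ≤
      ∫⁻ v : Fin (N + 1) → V3, ∫⁻ x : Fin (N + 1) → T3, (volume (posDomain (hsDiameter σ N) (N + 1)))⁻¹ *
          ((posDomain (hsDiameter σ N) N).indicator 1 (Fin.removeNth i x) *
            g (x i - x (i.succAbove j')) (v i - v (i.succAbove j'))) ∂volume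
        ∂(Measure.pi fun _ : Fin (N + 1) => gaussMeasure ubar θ) := by
  -- volumes and the partition function
  have hZ : canonicalPartition (Torus.geometry (Fin 3)) (hsDiameter σ N) (N + 1)
      (localGibbsProfile (fun _ => a) (fun _ => ubar) (fun _ => θ)) =
      a ^ (N + 1) * (volume (posDomain (hsDiameter σ N) (N + 1))).toReal := by
    rw [canonicalPartition_eq_posPartition continuous_const continuous_const continuous_const
      (fun _ => ha.le) (fun _ => hθ) (hsDiameter σ N) (N + 1), posPartition_const]
  have hZpos : 0 < a ^ (N + 1) * (volume (posDomain (hsDiameter σ N) (N + 1))).toReal := by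
    rw [← posPartition_const]
    exact posPartition_pos continuous_const (fun _ => ha) hσ2 N
  have hVn_top : volume (posDomain (hsDiameter σ N) (N + 1)) ≠ ⊤ := (measure_lt_top _ _).ne
  have hVn_pos : volume (posDomain (hsDiameter σ N) (N + 1)) ≠ 0 := by
    intro h0
    rw [h0, ENNReal.toReal_zero, mul_zero] at hZpos
    exact lt_irrefl _ hZpos
  have hcoef : ENNReal.ofReal ((a ^ (N + 1) * (volume (posDomain (hsDiameter σ N) (N + 1))).toReal)⁻¹ *
      a ^ (N + 1)) = (volume (posDomain (hsDiameter σ N) (N + 1)))⁻¹ := by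
    have han : (0 : ℝ) < a ^ (N + 1) := pow_pos ha _
    have hVr : 0 < (volume (posDomain (hsDiameter σ N) (N + 1))).toReal := ENNReal.toReal_pos hVn_pos hVn_top
    rw [show (a ^ (N + 1) * (volume (posDomain (hsDiameter σ N) (N + 1))).toReal)⁻¹ * a ^ (N + 1) =
        ((volume (posDomain (hsDiameter σ N) (N + 1))).toReal)⁻¹ by field_simp,
      ENNReal.ofReal_inv_of_pos hVr, ENNReal.ofReal_toReal hVn_top]
  -- measurability of the observable and of the relaxed integrand
  have hGm : Measurable fun z : Config (N + 1) (Fin 3) T3 =>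
      g ((z i).1 - (z (i.succAbove j')).1) ((z i).2 - (z (i.succAbove j')).2) := by
    change Measurable fun z : Config (N + 1) (Fin 3) T3 =>
      Function.uncurry g ((z i).1 - (z (i.succAbove j')).1, (z i).2 - (z (i.succAbove j')).2)
    exact hg.comp (((measurable_pi_apply i).fst.sub (measurable_pi_apply (i.succAbove j')).fst).prodMk
      ((measurable_pi_apply i).snd.sub (measurable_pi_apply (i.succAbove j')).snd))
  obtain ⟨Ψ, hΨ⟩ : ∃ Ψ : (Fin (N + 1) → T3) → (Fin (N + 1) → V3) → ℝ≥0∞, Ψ = fun x v =>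
      (volume (posDomain (hsDiameter σ N) (N + 1)))⁻¹ *
        ((posDomain (hsDiameter σ N) N).indicator 1 (Fin.removeNth i x) *
          g (x i - x (i.succAbove j')) (v i - v (i.succAbove j'))) := ⟨_, rfl⟩
  have hΨm : Measurable (Function.uncurry Ψ) := by
    rw [hΨ]
    refine measurable_const.mul (Measurable.mul ?_ ?_)
    · exact (measurable_one.indicator (measurableSet_posDomain _ N)).comp
        ((measurable_pi_lambda _ fun k => measurable_pi_apply _).comp measurable_fst)
    · change Measurable fun p : (Fin (N + 1) → T3) × (Fin (N + 1) → V3) =>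
        Function.uncurry g (p.1 i - p.1 (i.succAbove j'), p.2 i - p.2 (i.succAbove j'))
      refine hg.comp (Measurable.prodMk ?_ ?_)
      · exact ((measurable_pi_apply i).comp measurable_fst).sub
          ((measurable_pi_apply (i.succAbove j')).comp measurable_fst)
      · exact ((measurable_pi_apply i).comp measurable_snd).sub
          ((measurable_pi_apply (i.succAbove j')).comp measurable_snd)
  -- the disintegration, pointwise relaxation, and Tonelli
  have hstep1 : ∫⁻ z, g ((z i).1 - (z (i.succAbove j')).1) ((z i).2 - (z (i.succAbove j')).2)
      ∂localGibbsMeasure σ (fun _ => a) (fun _ => ubar) (fun _ => θ) N ≤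
      ∫⁻ x, ∫⁻ v, Ψ x v ∂(Measure.pi fun _ : Fin (N + 1) => gaussMeasure ubar θ) := by
    rw [lintegral_localGibbsMeasure continuous_const continuous_const continuous_const
        (fun _ => ha.le) (fun _ => hθ) σ N hGm]
    refine lintegral_mono fun x => ?_
    have hmeasv : Measurable fun v : Fin (N + 1) → V3 =>
        g ((zipConfig (x, v) i).1 - (zipConfig (x, v) (i.succAbove j')).1)
          ((zipConfig (x, v) i).2 - (zipConfig (x, v) (i.succAbove j')).2) :=
      hGm.comp (measurable_zipConfig.comp (measurable_const.prodMk measurable_id))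
    have hvel : velMeasure (fun _ : T3 => ubar) (fun _ : T3 => θ) x =
        Measure.pi fun _ : Fin (N + 1) => gaussMeasure ubar θ := rfl
    rw [hvel, hZ, ← lintegral_const_mul _ hmeasv]
    refine lintegral_mono fun v => ?_
    rw [posWeight_const, hΨ]
    simp only [zipConfig_apply]
    by_cases hx : x ∈ posDomain (hsDiameter σ N) (N + 1)
    · rw [indicator_of_mem hx, hcoef]
      have hrem : Fin.removeNth i x ∈ posDomain (hsDiameter σ N) N := by
        intro a' b' hab
        exact hx _ _ fun h => hab (Fin.succAbove_right_injective h)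
      rw [indicator_of_mem hrem, Pi.one_apply, one_mul]
    · rw [indicator_of_notMem hx, mul_zero, ENNReal.ofReal_zero, zero_mul]
      exact bot_le
  calc _ ≤ ∫⁻ x, ∫⁻ v, Ψ x v ∂(Measure.pi fun _ : Fin (N + 1) => gaussMeasure ubar θ) := hstep1
    _ = ∫⁻ v, ∫⁻ x, Ψ x v ∂volume ∂(Measure.pi fun _ : Fin (N + 1) => gaussMeasure ubar θ) :=
        lintegral_lintegral_swap hΨm.aemeasurable
    _ = _ := by rw [hΨ]

/-- **The pair weight under the homogeneous Gibbs law.** Under `G_N = localGibbsMeasure σ a ū θ N` (`a, θ > 0`,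
`0 < σ ≤ 1/4`), for labels `i ≠ j` and a jointly measurable weight `g(y, u)` with `∫ g(y − c, u) dy ≤ B` for all
`c, u`: `E_{G_N} g(xᵢ − xⱼ, vᵢ − vⱼ) ≤ 2B` (`lintegral_pairWeight_le_relaxed`, the position integral
`lintegral_pos_pairWeight_le`, the partition-function ratio `volume_posDomain_le_two_mul`; NO velocity moment is
needed since the bound `B` is uniform in `u`). [folklore] -/
theorem lintegral_pairWeight_le {a θ : ℝ} (ha : 0 < a) (hθ : 0 < θ) (ubar : V3) {σ : ℝ} (hσ : 0 < σ)
    (hσ4 : σ ≤ 1 / 4) (N : ℕ) {i j : Fin (N + 1)} (hij : i ≠ j)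
    {g : T3 → V3 → ℝ≥0∞} (hg : Measurable (Function.uncurry g)) {B : ℝ≥0∞}
    (hB : ∀ (c : T3) (u : V3), ∫⁻ y, g (y - c) u ≤ B) :
    ∫⁻ z, g ((z i).1 - (z j).1) ((z i).2 - (z j).2)
        ∂localGibbsMeasure σ (fun _ => a) (fun _ => ubar) (fun _ => θ) N ≤ 2 * B := by
  have hσ2 : σ ≤ 1 / 2 := hσ4.trans (by norm_num)
  obtain ⟨j', rfl⟩ := Fin.exists_succAbove_eq hij.symm
  set Vn := volume (posDomain (hsDiameter σ N) (N + 1)) with hVn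
  set VN := volume (posDomain (hsDiameter σ N) N) with hVN
  have hZpos : 0 < a ^ (N + 1) * Vn.toReal := by
    rw [← posPartition_const]
    exact posPartition_pos continuous_const (fun _ => ha) hσ2 N
  have hVn_top : Vn ≠ ⊤ := (measure_lt_top _ _).ne
  have hVn_pos : Vn ≠ 0 := by
    intro h0
    rw [h0, ENNReal.toReal_zero, mul_zero] at hZpos
    exact lt_irrefl _ hZpos
  have hratio : VN ≤ 2 * Vn := volume_posDomain_le_two_mul hσ hσ4 N i
  have hgv : ∀ v : Fin (N + 1) → V3, Measurable fun x : Fin (N + 1) → T3 =>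
      (posDomain (hsDiameter σ N) N).indicator 1 (Fin.removeNth i x) *
        g (x i - x (i.succAbove j')) (v i - v (i.succAbove j')) := by
    intro v
    refine Measurable.mul ?_ ?_
    · exact (measurable_one.indicator (measurableSet_posDomain _ N)).comp
        (measurable_pi_lambda _ fun k => measurable_pi_apply _)
    · have hgu : Measurable fun y : T3 => g y (v i - v (i.succAbove j')) :=
        hg.comp (measurable_id.prodMk measurable_const)
      exact hgu.comp ((measurable_pi_apply i).sub (measurable_pi_apply (i.succAbove j')))
  have hstep3 : ∀ v : Fin (N + 1) → V3, ∫⁻ x : Fin (N + 1) → T3, Vn⁻¹ *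
      ((posDomain (hsDiameter σ N) N).indicator 1 (Fin.removeNth i x) *
        g (x i - x (i.succAbove j')) (v i - v (i.succAbove j'))) ∂volume ≤ 2 * B := by
    intro v
    have hpos := lintegral_pos_pairWeight_le (ε := hsDiameter σ N) i j' hg hB (v i - v (i.succAbove j'))
    rw [lintegral_const_mul _ (hgv v)]
    calc Vn⁻¹ * ∫⁻ x : Fin (N + 1) → T3, (posDomain (hsDiameter σ N) N).indicator 1 (Fin.removeNth i x) *
            g (x i - x (i.succAbove j')) (v i - v (i.succAbove j'))
        ≤ Vn⁻¹ * (B * VN) := mul_le_mul_right hpos _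
      _ ≤ Vn⁻¹ * (B * (2 * Vn)) := mul_le_mul_right (mul_le_mul_right hratio _) _
      _ = 2 * B * (Vn⁻¹ * Vn) := by ring
      _ = 2 * B := by rw [ENNReal.inv_mul_cancel hVn_pos hVn_top, mul_one]
  calc ∫⁻ z, g ((z i).1 - (z (i.succAbove j')).1) ((z i).2 - (z (i.succAbove j')).2)
        ∂localGibbsMeasure σ (fun _ => a) (fun _ => ubar) (fun _ => θ) N
      ≤ ∫⁻ v : Fin (N + 1) → V3, ∫⁻ x : Fin (N + 1) → T3, Vn⁻¹ *
            ((posDomain (hsDiameter σ N) N).indicator 1 (Fin.removeNth i x) *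
              g (x i - x (i.succAbove j')) (v i - v (i.succAbove j'))) ∂volume
          ∂(Measure.pi fun _ : Fin (N + 1) => gaussMeasure ubar θ) :=
        lintegral_pairWeight_le_relaxed ha hθ ubar hσ2 N i j' hg
    _ ≤ ∫⁻ _v, 2 * B ∂(Measure.pi fun _ : Fin (N + 1) => gaussMeasure ubar θ) := lintegral_mono hstep3
    _ = 2 * B := by rw [lintegral_const, measure_univ, mul_one]

/-- **The pair-sum bound under the homogeneous Gibbs law.** For a jointly measurable weight `g(y, u)` with
`∫ g(y − c, u) dy ≤ B` for all `c, u`: `E_{G_N} Σ_{p ≠ q} g(x_p − x_q, v_p − v_q) ≤ 2 (N+1)² B`. [folklore] -/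
theorem lintegral_pairSum_le {a θ : ℝ} (ha : 0 < a) (hθ : 0 < θ) (ubar : V3) {σ : ℝ} (hσ : 0 < σ)
    (hσ4 : σ ≤ 1 / 4) (N : ℕ) {g : T3 → V3 → ℝ≥0∞} (hg : Measurable (Function.uncurry g)) {B : ℝ≥0∞}
    (hB : ∀ (c : T3) (u : V3), ∫⁻ y, g (y - c) u ≤ B) :
    ∫⁻ z, ∑ p : Fin (N + 1), ∑ q ∈ Finset.univ.erase p, g ((z p).1 - (z q).1) ((z p).2 - (z q).2)
        ∂localGibbsMeasure σ (fun _ => a) (fun _ => ubar) (fun _ => θ) N ≤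
      2 * ((N : ℝ≥0∞) + 1) ^ 2 * B := by
  have hterm : ∀ p q : Fin (N + 1), Measurable fun z : Config (N + 1) (Fin 3) T3 =>
      g ((z p).1 - (z q).1) ((z p).2 - (z q).2) := by
    intro p q
    change Measurable fun z : Config (N + 1) (Fin 3) T3 =>
      Function.uncurry g ((z p).1 - (z q).1, (z p).2 - (z q).2)
    exact hg.comp (((measurable_pi_apply p).fst.sub (measurable_pi_apply q).fst).prodMk
      ((measurable_pi_apply p).snd.sub (measurable_pi_apply q).snd))
  rw [lintegral_finsetSum _ fun p _ => Finset.measurable_sum _ fun q _ => hterm p q]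
  calc ∑ p : Fin (N + 1), ∫⁻ z, ∑ q ∈ Finset.univ.erase p, g ((z p).1 - (z q).1) ((z p).2 - (z q).2)
        ∂localGibbsMeasure σ (fun _ => a) (fun _ => ubar) (fun _ => θ) N
      = ∑ p : Fin (N + 1), ∑ q ∈ Finset.univ.erase p, ∫⁻ z, g ((z p).1 - (z q).1) ((z p).2 - (z q).2)
          ∂localGibbsMeasure σ (fun _ => a) (fun _ => ubar) (fun _ => θ) N := by
        refine Finset.sum_congr rfl fun p _ => ?_
        rw [lintegral_finsetSum _ fun q _ => hterm p q]
    _ ≤ ∑ p : Fin (N + 1), ∑ q ∈ Finset.univ.erase p, 2 * B := by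
        refine Finset.sum_le_sum fun p _ => Finset.sum_le_sum fun q hq => ?_
        exact lintegral_pairWeight_le ha hθ ubar hσ hσ4 N (Finset.ne_of_mem_erase hq).symm hg hB
    _ ≤ ∑ _p : Fin (N + 1), ∑ _q : Fin (N + 1), 2 * B :=
        Finset.sum_le_sum fun p _ => Finset.sum_le_sum_of_subset_of_nonneg (Finset.erase_subset _ _)
          fun _ _ _ => bot_le
    _ = 2 * ((N : ℝ≥0∞) + 1) ^ 2 * B := by
        simp only [Finset.sum_const, Finset.card_univ, Fintype.card_fin, nsmul_eq_mul]
        push_cast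
        ring


end Summit.AtomisticToContinuum.HydrodynamicLimit.Theorems

end
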